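import Literature.MathematicalPhysics.QuantumLattice.YangMillsSphereEnergyRadial
import Literature.MathematicalPhysics.QuantumLattice.YangMillsHodgeDualHeat
import Literature.MathematicalPhysics.QuantumLattice.YangMillsSphereSectionIBP
import Literature.MathematicalPhysics.QuantumLattice.YangMillsHeatFlowDivBochner
import HarnessLib

/-!
# Time derivative of the sphere energy of the Hodge-dual field along the flow

QuantumLattice support file (everything proved; no definitions, no named facts) on the proof
path of `Literature.MathematicalPhysics.QuantumLattice.Waldron2019_yangMillsFlow_flatTorus`
(A. Waldron, Invent. math. 217 (2019)), §4.2: along a smooth `𝔲(N)`-valued solution of the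
Yang–Mills heat flow on `𝒯 × ℝ⁴`, the sphere energy `q(s) = ∮_{S_r} ∑ₐ ‖u_a(s)‖²` of the
Hodge-dual field satisfies (`sphereEnergy_time_identity`)

`r² ∂ₜ q = −∑ᵢⱼ∑ₐ ∮‖D_{L_{ij}} u_a‖² + 2∮∑ₐ⟨u_a, D_xD_x u_a⟩ + 6∮∑ₐ⟨u_a, D_x u_a⟩ + 2r²∮∑ₐ⟨u_a, N_a⟩`,

combining `hasDerivAt_hodgeSec_of_flow` (the `u`-heat equation), the scalar Casimir split
`sum_sum_covDeriv_covDeriv_angularField` and the sphere integration by parts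
`sphereIntegral_inner_covDeriv_covDeriv_angular`. With `YangMillsSphereEnergyRadial`
(`r q' = 2∮∑⟨u_a, D_x u_a⟩`, `r² q'' = 2∮∑‖D_xu_a‖² + 2∮∑⟨u_a, D_xD_xu_a⟩`) this is Waldron's
(4.10)-type identity `r²∂ₜ q = −2X + r²q'' − 2R + 3 r q' + (nonlinear)`.

* `contDiffOn_hodgeSec_joint`, `contDiffOn_sphereEnergyDensity_joint` — joint smoothness;
* `hasDerivAt_sphereEnergy_time` — `∂ₜ q = ∮ 2∑ₐ⟨u_a, ∑ᵢDᵢDᵢu_a + N_a⟩`;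
* `inner_laplacian_casimir` — pointwise Casimir split paired with `u_a`;
* `sphereEnergy_time_identity`.

References: A. Waldron, Invent. math. 217 (2019), §4.2 [Waldron2019]; [folklore].
-/

noncomputable section

open scoped RealInnerProductSpace Matrix.Norms.Frobenius Topology ContDiff
open Set MeasureTheory Metric Filter
open Literature.Analysis.FluidPDE Literature.Analysis.Calculus Literature.Analysis.InnerProduct

namespace Literature.MathematicalPhysics.QuantumLattice

attribute [local instance] frobeniusInnerProductSpace

variable {N : ℕ}

local notation "𝔼" => EuclideanSpace ℝ (Fin 4)
local notation "𝕓" => EuclideanSpace.basisFun (Fin 4) ℝ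
local notation "𝔤" => Matrix (Fin N) (Fin N) ℂ

/-! ### Joint smoothness -/

/-- The Hodge-dual sections of a jointly `C^n` family are jointly `C^m` for `m + 1 ≤ n`.
[folklore] -/
theorem contDiffOn_hodgeSec_joint {n m : WithTop ℕ∞} {A : ℝ → Connection 𝔼 𝔤} {U : Set (ℝ × 𝔼)}
    (hU : IsOpen U) (hA : ContDiffOn ℝ n (fun p : ℝ × 𝔼 => A p.1 p.2) U) (hmn : m + 1 ≤ n) (a : Fin 4) :
    ContDiffOn ℝ m (fun p : ℝ × 𝔼 => hodgeSec 𝕓 (A p.1) a p.2) U := by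
  unfold hodgeSec
  refine ContDiffOn.const_smul (1 / 2 : ℝ) ?_
  refine ContDiffOn.sum fun b _ => ContDiffOn.sum fun c _ => ContDiffOn.sum fun d _ => ?_
  have hlin : ContDiff ℝ m fun p : ℝ × 𝔼 => ((lc4 a b c d : ℤ) : ℝ) * ⟪p.2, 𝕓 b⟫ :=
    contDiff_const.mul (contDiff_snd.inner ℝ contDiff_const)
  exact hlin.contDiffOn.smul (contDiffOn_curvature_joint hU hA hmn _ _)

/-- The energy density `(s, x) ↦ ∑ₐ ‖u_a(s, x)‖²` is jointly `C^m` for `m + 1 ≤ n`. [folklore] -/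
theorem contDiffOn_sphereEnergyDensity_joint {n m : WithTop ℕ∞} {A : ℝ → Connection 𝔼 𝔤}
    {U : Set (ℝ × 𝔼)} (hU : IsOpen U) (hA : ContDiffOn ℝ n (fun p : ℝ × 𝔼 => A p.1 p.2) U)
    (hmn : m + 1 ≤ n) :
    ContDiffOn ℝ m (fun p : ℝ × 𝔼 => ∑ a, ‖hodgeSec 𝕓 (A p.1) a p.2‖ ^ 2) U :=
  ContDiffOn.sum fun a _ => (contDiffOn_hodgeSec_joint hU hA hmn a).norm_sq ℝ

/-! ### The time derivative -/

/-- **`∂ₜ ∮_{S_r} ∑ₐ‖u_a‖² = ∮_{S_r} 2∑ₐ ⟨u_a, ∑ᵢDᵢDᵢu_a + N_a⟩`** along the flow. [folklore] -/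
theorem hasDerivAt_sphereEnergy_time {A : ℝ → Connection 𝔼 𝔤} {𝒯 : Set ℝ} (h𝒯 : IsOpen 𝒯)
    (hA : ContDiffOn ℝ ∞ (fun p : ℝ × 𝔼 => A p.1 p.2) (𝒯 ×ˢ (univ : Set 𝔼)))
    (hpde : ∀ ⦃s : ℝ⦄, s ∈ 𝒯 → ∀ y w, deriv (fun s' => A s' y w) s = divCurvature (A s) y w)
    {t : ℝ} (ht : t ∈ 𝒯) {r : ℝ} (hr : 0 < r) :
    HasDerivAt (fun s => sphereIntegral (volume : Measure 𝔼) (fun x => ∑ a, ‖hodgeSec 𝕓 (A s) a x‖ ^ 2) r)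
      (sphereIntegral (volume : Measure 𝔼) (fun x => 2 * ∑ a, ⟪hodgeSec 𝕓 (A t) a x,
        ∑ i, covDeriv (A t) (fun y => covDeriv (A t) (hodgeSec 𝕓 (A t) a) y (𝕓 i)) x (𝕓 i) +
          hodgeNonlin 𝕓 (A t) a x⟫) r) t := by
  haveI : Nontrivial 𝔼 := inferInstance
  have hO : IsOpen (𝒯 ×ˢ (univ : Set 𝔼)) := h𝒯.prod isOpen_univ
  set Q : ℝ × 𝔼 → ℝ := fun p => ∑ a, ‖hodgeSec 𝕓 (A p.1) a p.2‖ ^ 2 with hQ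
  have hQ1 : ContDiffOn ℝ 1 Q (𝒯 ×ˢ (univ : Set 𝔼)) :=
    contDiffOn_sphereEnergyDensity_joint (m := 1) hO hA (by rw [show ((1 : WithTop ℕ∞) + 1) = 2 by norm_num]; exact ENat.LEInfty.out)
  have h := hasDerivAt_sphereIntegral_param (q := fun s x => ∑ a, ‖hodgeSec 𝕓 (A s) a x‖ ^ 2) h𝒯
    (hQ1.mono (prod_mono le_rfl (subset_univ _))) hr ht
  refine h.congr_deriv ?_
  rw [sphereIntegral_def]
  refine integral_congr_ae (ae_of_all _ fun θ => ?_)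
  set y : 𝔼 := r • (θ : 𝔼) with hy
  -- the time derivative of `s ↦ ∑ₐ ‖u_a(s, y)‖²`
  have h1 : HasDerivAt (fun s => Q (s, y)) (fderiv ℝ Q (t, y) ((1 : ℝ), (0 : 𝔼))) t :=
    hasDerivAt_timeSlice hO hQ1 one_ne_zero ⟨ht, mem_univ y⟩
  have h2 : HasDerivAt (fun s => Q (s, y)) (2 * ∑ a, ⟪hodgeSec 𝕓 (A t) a y,
      ∑ i, covDeriv (A t) (fun z => covDeriv (A t) (hodgeSec 𝕓 (A t) a) z (𝕓 i)) y (𝕓 i) +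
        hodgeNonlin 𝕓 (A t) a y⟫) t := by
    have hterm := fun a => (hasDerivAt_hodgeSec_of_flow 𝕓 h𝒯 hA hpde ht a y).norm_sq
    have hsum := HasDerivAt.fun_sum fun a (_ : a ∈ Finset.univ) => hterm a
    rw [Finset.mul_sum]
    exact hsum
  exact h1.unique h2

/-! ### The Casimir split paired with a section, and the integrated identity (general sections) -/

section General

/-- **Pointwise Casimir split paired with `φ`**: for a `C¹` connection, a `C²` section and `x`,
`2⟨φ, ‖x‖² ∑ₖDₖDₖφ⟩ = ⟨φ, ∑ᵢⱼ D_{L}D_{L}φ⟩ + 2⟨φ, D_xD_xφ⟩ + 6⟨φ, D_xφ⟩`. [folklore] -/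
theorem inner_laplacian_casimir {B : Connection 𝔼 𝔤} (hB : ContDiff ℝ 1 B) {φ : 𝔼 → 𝔤} (hφ : ContDiff ℝ 2 φ) (x : 𝔼) :
    2 * ⟪φ x, ‖x‖ ^ 2 • ∑ k, covDeriv B (fun y => covDeriv B φ y (𝕓 k)) x (𝕓 k)⟫ =
      ⟪φ x, ∑ i, ∑ j, covDeriv B (fun y => covDeriv B φ y (angularField 𝕓 i j y)) x (angularField 𝕓 i j x)⟫ +
        2 * ⟪φ x, covDeriv B (fun y => covDeriv B φ y x) x x⟫ + 6 * ⟪φ x, covDeriv B φ x x⟫ := by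
  classical
  have hBd : DifferentiableAt ℝ B x := (hB.differentiable (by simp)) x
  have hφd : DifferentiableAt ℝ φ x := (hφ.differentiable two_ne_zero) x
  have hφ2 : DifferentiableAt ℝ (fderiv ℝ φ) x := ((hφ.fderiv_right (m := 1) le_rfl).differentiable (by simp)) x
  have h := sum_sum_covDeriv_covDeriv_angularField 𝕓 hBd hφd hφ2
  simp only [Fintype.card_fin, Nat.cast_ofNat] at h
  rw [h]
  simp only [smul_sub, inner_smul_right, inner_sub_right]
  ring

/-- **Pointwise density identity** for a family of `C²` sections `φ_a` and arbitrary `n_a`: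
`‖x‖²·2∑ₐ⟨φ_a, ∑ᵢDᵢDᵢφ_a + n_a⟩ = ∑ₐ⟨φ_a, ∑ᵢⱼD_LD_Lφ_a⟩ + (2∑ₐ(‖D_xφ_a‖² + ⟨φ_a,D_xD_xφ_a⟩) − 2∑ₐ‖D_xφ_a‖²)
  + 3·2∑ₐ⟨φ_a, D_xφ_a⟩ + 2‖x‖²∑ₐ⟨φ_a, n_a⟩`. [folklore] -/
theorem section_density_identity {B : Connection 𝔼 𝔤} (hB : ContDiff ℝ 1 B) {φ : Fin 4 → 𝔼 → 𝔤} (hφ : ∀ a, ContDiff ℝ 2 (φ a))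
    (n : Fin 4 → 𝔼 → 𝔤) (x : 𝔼) :
    ‖x‖ ^ 2 * (2 * ∑ a, ⟪φ a x, ∑ i, covDeriv B (fun y => covDeriv B (φ a) y (𝕓 i)) x (𝕓 i) + n a x⟫) =
      ∑ a, ⟪φ a x, ∑ i, ∑ j, covDeriv B (fun y => covDeriv B (φ a) y (angularField 𝕓 i j y)) x (angularField 𝕓 i j x)⟫ +
        (2 * ∑ a, (‖covDeriv B (φ a) x x‖ ^ 2 + ⟪φ a x, covDeriv B (fun y => covDeriv B (φ a) y x) x x⟫) -
          2 * ∑ a, ‖covDeriv B (φ a) x x‖ ^ 2) +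
        3 * (2 * ∑ a, ⟪φ a x, covDeriv B (φ a) x x⟫) + 2 * ‖x‖ ^ 2 * ∑ a, ⟪φ a x, n a x⟫ := by
  have hper : ∀ a, ‖x‖ ^ 2 * (2 * ⟪φ a x, ∑ i, covDeriv B (fun y => covDeriv B (φ a) y (𝕓 i)) x (𝕓 i) + n a x⟫) =
      ⟪φ a x, ∑ i, ∑ j, covDeriv B (fun y => covDeriv B (φ a) y (angularField 𝕓 i j y)) x (angularField 𝕓 i j x)⟫ +
        (2 * (‖covDeriv B (φ a) x x‖ ^ 2 + ⟪φ a x, covDeriv B (fun y => covDeriv B (φ a) y x) x x⟫) -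
          2 * ‖covDeriv B (φ a) x x‖ ^ 2) +
        3 * (2 * ⟪φ a x, covDeriv B (φ a) x x⟫) + 2 * ‖x‖ ^ 2 * ⟪φ a x, n a x⟫ := by
    intro a
    have hc := inner_laplacian_casimir hB (hφ a) x
    rw [inner_smul_right] at hc
    rw [inner_add_right]
    linear_combination hc
  have aux : ∀ (f g h k l : Fin 4 → ℝ) (c : ℝ),
      ∑ a, (f a + (2 * g a - 2 * h a) + 3 * (2 * k a) + c * l a) =
        ∑ a, f a + (2 * ∑ a, g a - 2 * ∑ a, h a) + 3 * (2 * ∑ a, k a) + c * ∑ a, l a := by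
    intro f g h k l c
    simp only [Finset.sum_add_distrib, Finset.sum_sub_distrib, ← Finset.mul_sum]
  rw [Finset.mul_sum, Finset.mul_sum, Finset.sum_congr rfl fun a _ => hper a]
  exact aux (fun a => ⟪φ a x, ∑ i, ∑ j, covDeriv B (fun y => covDeriv B (φ a) y (angularField 𝕓 i j y)) x
      (angularField 𝕓 i j x)⟫)
    (fun a => ‖covDeriv B (φ a) x x‖ ^ 2 + ⟪φ a x, covDeriv B (fun y => covDeriv B (φ a) y x) x x⟫)
    (fun a => ‖covDeriv B (φ a) x x‖ ^ 2) (fun a => ⟪φ a x, covDeriv B (φ a) x x⟫)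
    (fun a => ⟪φ a x, n a x⟫) (2 * ‖x‖ ^ 2)

/-- Continuity of `x ↦ D_{L(x)} ψ(x)` for `ψ ∈ C¹`. [folklore] -/
theorem continuous_covDeriv_angular_of_contDiff {B : Connection 𝔼 𝔤} (hB : ContDiff ℝ 1 B) {ψ : 𝔼 → 𝔤} (hψ : ContDiff ℝ 1 ψ)
    (i j : Fin 4) : Continuous fun x => covDeriv B ψ x (angularField 𝕓 i j x) := by
  have hL : Continuous fun y : 𝔼 => angularField 𝕓 i j y := continuous_angularField 𝕓 i j
  unfold covDeriv
  refine Continuous.add ((hψ.continuous_fderiv one_ne_zero).clm_apply hL) ?_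
  simp only [Ring.lie_def]
  have hBL : Continuous fun y => B y (angularField 𝕓 i j y) := hB.continuous.clm_apply hL
  exact (hBL.mul hψ.continuous).sub (hψ.continuous.mul hBL)

/-- The angular pairing `⟨φ_a, D_{L_{ij}}D_{L_{ij}}φ_a⟩` as a named function. [folklore] -/
def angPair (B : Connection 𝔼 𝔤) (φ : Fin 4 → 𝔼 → 𝔤) (a i j : Fin 4) (x : 𝔼) : ℝ :=
  ⟪φ a x, covDeriv B (fun y => covDeriv B (φ a) y (angularField 𝕓 i j y)) x (angularField 𝕓 i j x)⟫

/-- The angular energy density `‖D_{L_{ij}}φ_a‖²` as a named function. [folklore] -/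
def angSq (B : Connection 𝔼 𝔤) (φ : Fin 4 → 𝔼 → 𝔤) (a i j : Fin 4) (x : 𝔼) : ℝ :=
  ‖covDeriv B (φ a) x (angularField 𝕓 i j x)‖ ^ 2

/-- Continuity of `angPair`. [folklore] -/
theorem continuous_angPair {B : Connection 𝔼 𝔤} (hB : ContDiff ℝ 1 B) {φ : Fin 4 → 𝔼 → 𝔤}
    (hφ : ∀ a, ContDiff ℝ 2 (φ a)) (a i j : Fin 4) : Continuous (angPair B φ a i j) :=
  (hφ a).continuous.inner (continuous_covDeriv_angular_of_contDiff hB (contDiff_covDeriv_angular 𝕓 i j hB (hφ a)) i j)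

/-- Continuity of `angSq`. [folklore] -/
theorem continuous_angSq {B : Connection 𝔼 𝔤} (hB : ContDiff ℝ 1 B) {φ : Fin 4 → 𝔼 → 𝔤}
    (hφ : ∀ a, ContDiff ℝ 2 (φ a)) (a i j : Fin 4) : Continuous (angSq B φ a i j) :=
  ((contDiff_covDeriv_angular 𝕓 i j hB (hφ a)).continuous.norm).pow 2

/-- Integration by parts for each `(a, i, j)`. [folklore] -/
theorem sphereIntegral_angPair {B : Connection 𝔼 𝔤} (hB : ContDiff ℝ 1 B)
    (hval : B.IsValuedIn (skewAdjoint.submodule ℝ 𝔤)) {φ : Fin 4 → 𝔼 → 𝔤} (hφ : ∀ a, ContDiff ℝ 2 (φ a))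
    {r : ℝ} (hr : 0 < r) (a i j : Fin 4) :
    sphereIntegral (volume : Measure 𝔼) (angPair B φ a i j) r = -sphereIntegral (volume : Measure 𝔼) (angSq B φ a i j) r :=
  haveI : Nontrivial 𝔼 := inferInstance
  sphereIntegral_inner_covDeriv_covDeriv_angular 𝕓 i j hB hval (hφ a) hr

/-- **The angular term integrates by parts** (family of `C²` sections, skew-valued `C¹` connection):
`∮ ∑ₐ⟨φ_a, ∑ᵢⱼ D_LD_Lφ_a⟩ = −∮ ∑ᵢⱼ∑ₐ ‖D_Lφ_a‖²`. [folklore] -/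
theorem sphereIntegral_inner_sum_casimir {B : Connection 𝔼 𝔤} (hB : ContDiff ℝ 1 B)
    (hval : B.IsValuedIn (skewAdjoint.submodule ℝ 𝔤))
    {φ : Fin 4 → 𝔼 → 𝔤} (hφ : ∀ a, ContDiff ℝ 2 (φ a)) {r : ℝ} (hr : 0 < r) :
    sphereIntegral (volume : Measure 𝔼) (fun x => ∑ a, ⟪φ a x, ∑ i, ∑ j,
        covDeriv B (fun y => covDeriv B (φ a) y (angularField 𝕓 i j y)) x (angularField 𝕓 i j x)⟫) r =
      -sphereIntegral (volume : Measure 𝔼)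
        (fun x => ∑ i, ∑ j, ∑ a, ‖covDeriv B (φ a) x (angularField 𝕓 i j x)‖ ^ 2) r := by
  haveI : Nontrivial 𝔼 := inferInstance
  have hGc := continuous_angPair hB hφ
  have hHc := continuous_angSq hB hφ
  -- rewrite both integrands through the named functions
  have heqL : (fun x => ∑ a, ⟪φ a x, ∑ i, ∑ j,
      covDeriv B (fun y => covDeriv B (φ a) y (angularField 𝕓 i j y)) x (angularField 𝕓 i j x)⟫) =
      fun x => ∑ a, ∑ i, ∑ j, angPair B φ a i j x := by
    funext x; simp only [angPair, inner_sum]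
  have heqR : (fun x => ∑ i, ∑ j, ∑ a, ‖covDeriv B (φ a) x (angularField 𝕓 i j x)‖ ^ 2) =
      fun x => ∑ i, ∑ j, ∑ a, angSq B φ a i j x := rfl
  rw [heqL, heqR]
  have hL : sphereIntegral (volume : Measure 𝔼) (fun x => ∑ a, ∑ i, ∑ j, angPair B φ a i j x) r =
      ∑ a, ∑ i, ∑ j, sphereIntegral (volume : Measure 𝔼) (angPair B φ a i j) r := by
    rw [sphereIntegral_finset_sum Finset.univ (g := fun a x => ∑ i, ∑ j, angPair B φ a i j x)
      (fun a _ => continuousOn_finsetSum _ fun i _ => continuousOn_finsetSum _ fun j _ => (hGc a i j).continuousOn) hr]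
    refine Finset.sum_congr rfl fun a _ => ?_
    rw [sphereIntegral_finset_sum Finset.univ (g := fun i x => ∑ j, angPair B φ a i j x)
      (fun i _ => continuousOn_finsetSum _ fun j _ => (hGc a i j).continuousOn) hr]
    refine Finset.sum_congr rfl fun i _ => ?_
    exact sphereIntegral_finset_sum Finset.univ (g := fun j x => angPair B φ a i j x) (fun j _ => (hGc a i j).continuousOn) hr
  have hR : sphereIntegral (volume : Measure 𝔼) (fun x => ∑ i, ∑ j, ∑ a, angSq B φ a i j x) r =
      ∑ i, ∑ j, ∑ a, sphereIntegral (volume : Measure 𝔼) (angSq B φ a i j) r := by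
    rw [sphereIntegral_finset_sum Finset.univ (g := fun i x => ∑ j, ∑ a, angSq B φ a i j x)
      (fun i _ => continuousOn_finsetSum _ fun j _ => continuousOn_finsetSum _ fun a _ => (hHc a i j).continuousOn) hr]
    refine Finset.sum_congr rfl fun i _ => ?_
    rw [sphereIntegral_finset_sum Finset.univ (g := fun j x => ∑ a, angSq B φ a i j x)
      (fun j _ => continuousOn_finsetSum _ fun a _ => (hHc a i j).continuousOn) hr]
    refine Finset.sum_congr rfl fun j _ => ?_
    exact sphereIntegral_finset_sum Finset.univ (g := fun a x => angSq B φ a i j x) (fun a _ => (hHc a i j).continuousOn) hr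
  rw [hL, hR, Finset.sum_congr rfl fun a _ => Finset.sum_congr rfl fun i _ =>
    Finset.sum_congr rfl fun j _ => sphereIntegral_angPair hB hval hφ hr a i j]
  simp only [Finset.sum_neg_distrib]
  rw [neg_inj, Finset.sum_comm]
  refine Finset.sum_congr rfl fun i _ => ?_
  rw [Finset.sum_comm]

/-- Continuity of `x ↦ D_x φ(x)` for `φ ∈ C²`, `B ∈ C¹`. [folklore] -/
theorem continuous_covDeriv_radial {B : Connection 𝔼 𝔤} (hB : ContDiff ℝ 1 B) {φ : 𝔼 → 𝔤} (hφ : ContDiff ℝ 2 φ) :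
    Continuous fun x : 𝔼 => covDeriv B φ x x := by
  unfold covDeriv
  refine Continuous.add ((hφ.continuous_fderiv two_ne_zero).clm_apply continuous_id) ?_
  simp only [Ring.lie_def]
  have hBx : Continuous fun y : 𝔼 => B y y := hB.continuous.clm_apply continuous_id
  exact (hBx.mul hφ.continuous).sub (hφ.continuous.mul hBx)

/-- Continuity of the angular Casimir pairing. [folklore] -/
theorem continuous_inner_sum_casimir {B : Connection 𝔼 𝔤} (hB : ContDiff ℝ 1 B) {φ : Fin 4 → 𝔼 → 𝔤} (hφ : ∀ a, ContDiff ℝ 2 (φ a)) :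
    Continuous fun x : 𝔼 => ∑ a, ⟪φ a x, ∑ i, ∑ j,
      covDeriv B (fun y => covDeriv B (φ a) y (angularField 𝕓 i j y)) x (angularField 𝕓 i j x)⟫ := by
  refine continuous_finsetSum _ fun a _ => (hφ a).continuous.inner ?_
  refine continuous_finsetSum _ fun i _ => continuous_finsetSum _ fun j _ => ?_
  exact continuous_covDeriv_angular_of_contDiff hB (contDiff_covDeriv_angular 𝕓 i j hB (hφ a)) i j

/-- **The integrated identity for a family of sections** (skew-valued `C¹` connection, `C²`
sections, arbitrary continuous `n_a`, `r > 0`), with the frozen radial pairing assumed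
continuous:
`r² ∮ 2∑ₐ⟨φ_a, ∑ᵢDᵢDᵢφ_a + n_a⟩ = −∮∑ᵢⱼₐ‖D_Lφ_a‖² + (∮2∑ₐ(‖D_xφ_a‖² + ⟨φ_a,D_xD_xφ_a⟩) − 2∮∑ₐ‖D_xφ_a‖²)
  + 3∮2∑ₐ⟨φ_a, D_xφ_a⟩ + 2r²∮∑ₐ⟨φ_a, n_a⟩`. [folklore] -/
theorem section_sphere_identity {B : Connection 𝔼 𝔤} (hB : ContDiff ℝ 1 B) (hval : B.IsValuedIn (skewAdjoint.submodule ℝ 𝔤))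
    {φ : Fin 4 → 𝔼 → 𝔤} (hφ : ∀ a, ContDiff ℝ 2 (φ a)) {n : Fin 4 → 𝔼 → 𝔤} (hn : ∀ a, Continuous (n a))
    (hrad2 : Continuous fun x : 𝔼 => 2 * ∑ a, (‖covDeriv B (φ a) x x‖ ^ 2 +
      ⟪φ a x, covDeriv B (fun y => covDeriv B (φ a) y x) x x⟫))
    {r : ℝ} (hr : 0 < r) :
    r ^ 2 * sphereIntegral (volume : Measure 𝔼)
        (fun x => 2 * ∑ a, ⟪φ a x, ∑ i, covDeriv B (fun y => covDeriv B (φ a) y (𝕓 i)) x (𝕓 i) + n a x⟫) r =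
      -sphereIntegral (volume : Measure 𝔼) (fun x => ∑ i, ∑ j, ∑ a, ‖covDeriv B (φ a) x (angularField 𝕓 i j x)‖ ^ 2) r +
        (sphereIntegral (volume : Measure 𝔼) (fun x => 2 * ∑ a, (‖covDeriv B (φ a) x x‖ ^ 2 +
            ⟪φ a x, covDeriv B (fun y => covDeriv B (φ a) y x) x x⟫)) r -
          2 * sphereIntegral (volume : Measure 𝔼) (fun x => ∑ a, ‖covDeriv B (φ a) x x‖ ^ 2) r) +
        3 * sphereIntegral (volume : Measure 𝔼) (fun x => 2 * ∑ a, ⟪φ a x, covDeriv B (φ a) x x⟫) r +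
        2 * r ^ 2 * sphereIntegral (volume : Measure 𝔼) (fun x => ∑ a, ⟪φ a x, n a x⟫) r := by
  haveI : Nontrivial 𝔼 := inferInstance
  have huc : ∀ a, Continuous (φ a) := fun a => (hφ a).continuous
  have c1 := continuous_inner_sum_casimir hB hφ
  have c2b : Continuous fun x : 𝔼 => 2 * ∑ a, ‖covDeriv B (φ a) x x‖ ^ 2 :=
    continuous_const.mul (continuous_finsetSum _ fun a _ => ((continuous_covDeriv_radial hB (hφ a)).norm).pow 2)
  have c3 : Continuous fun x : 𝔼 => 3 * (2 * ∑ a, ⟪φ a x, covDeriv B (φ a) x x⟫) :=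
    continuous_const.mul (continuous_const.mul (continuous_finsetSum _ fun a _ =>
      (huc a).inner (continuous_covDeriv_radial hB (hφ a))))
  have c4 : Continuous fun x : 𝔼 => 2 * r ^ 2 * ∑ a, ⟪φ a x, n a x⟫ :=
    continuous_const.mul (continuous_finsetSum _ fun a _ => (huc a).inner (hn a))
  have hpt : ∀ x : 𝔼, ‖x‖ = r →
      r ^ 2 * (2 * ∑ a, ⟪φ a x, ∑ i, covDeriv B (fun y => covDeriv B (φ a) y (𝕓 i)) x (𝕓 i) + n a x⟫) =
      ∑ a, ⟪φ a x, ∑ i, ∑ j, covDeriv B (fun y => covDeriv B (φ a) y (angularField 𝕓 i j y)) x (angularField 𝕓 i j x)⟫ +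
        (2 * ∑ a, (‖covDeriv B (φ a) x x‖ ^ 2 + ⟪φ a x, covDeriv B (fun y => covDeriv B (φ a) y x) x x⟫) -
          2 * ∑ a, ‖covDeriv B (φ a) x x‖ ^ 2) +
        3 * (2 * ∑ a, ⟪φ a x, covDeriv B (φ a) x x⟫) + 2 * r ^ 2 * ∑ a, ⟪φ a x, n a x⟫ := by
    intro x hx
    have h := section_density_identity hB hφ n x
    rw [hx] at h
    exact h
  rw [← sphereIntegral_mul_left, sphereIntegral_congr_norm hr.le hpt]
  rw [sphereIntegral_add_of
    (fun x : 𝔼 => ∑ a, ⟪φ a x, ∑ i, ∑ j, covDeriv B (fun y => covDeriv B (φ a) y (angularField 𝕓 i j y)) x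
        (angularField 𝕓 i j x)⟫ +
      (2 * ∑ a, (‖covDeriv B (φ a) x x‖ ^ 2 + ⟪φ a x, covDeriv B (fun y => covDeriv B (φ a) y x) x x⟫) -
        2 * ∑ a, ‖covDeriv B (φ a) x x‖ ^ 2) + 3 * (2 * ∑ a, ⟪φ a x, covDeriv B (φ a) x x⟫))
    (fun x : 𝔼 => 2 * r ^ 2 * ∑ a, ⟪φ a x, n a x⟫) ((c1.add (hrad2.sub c2b)).add c3).continuousOn c4.continuousOn hr]
  rw [sphereIntegral_add_of
    (fun x : 𝔼 => ∑ a, ⟪φ a x, ∑ i, ∑ j, covDeriv B (fun y => covDeriv B (φ a) y (angularField 𝕓 i j y)) x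
        (angularField 𝕓 i j x)⟫ +
      (2 * ∑ a, (‖covDeriv B (φ a) x x‖ ^ 2 + ⟪φ a x, covDeriv B (fun y => covDeriv B (φ a) y x) x x⟫) -
        2 * ∑ a, ‖covDeriv B (φ a) x x‖ ^ 2))
    (fun x : 𝔼 => 3 * (2 * ∑ a, ⟪φ a x, covDeriv B (φ a) x x⟫)) (c1.add (hrad2.sub c2b)).continuousOn c3.continuousOn hr]
  rw [sphereIntegral_add_of
    (fun x : 𝔼 => ∑ a, ⟪φ a x, ∑ i, ∑ j, covDeriv B (fun y => covDeriv B (φ a) y (angularField 𝕓 i j y)) x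
        (angularField 𝕓 i j x)⟫)
    (fun x : 𝔼 => 2 * ∑ a, (‖covDeriv B (φ a) x x‖ ^ 2 + ⟪φ a x, covDeriv B (fun y => covDeriv B (φ a) y x) x x⟫) -
        2 * ∑ a, ‖covDeriv B (φ a) x x‖ ^ 2) c1.continuousOn (hrad2.sub c2b).continuousOn hr]
  rw [sphereIntegral_sub_of
    (fun x : 𝔼 => 2 * ∑ a, (‖covDeriv B (φ a) x x‖ ^ 2 + ⟪φ a x, covDeriv B (fun y => covDeriv B (φ a) y x) x x⟫))
    (fun x : 𝔼 => 2 * ∑ a, ‖covDeriv B (φ a) x x‖ ^ 2) hrad2.continuousOn c2b.continuousOn hr]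
  rw [sphereIntegral_inner_sum_casimir hB hval hφ hr]
  simp only [sphereIntegral_mul_left]

end General

/-! ### Specialization to the Hodge-dual field -/

/-- **The integrated identity for the Hodge-dual field** (fixed `C³` skew-valued connection,
`r > 0`), in the form matching `YangMillsSphereEnergyRadial`:
`r² ∮ 2∑ₐ⟨u_a, ∑ᵢDᵢDᵢu_a + N_a⟩ = −∮∑ᵢⱼₐ‖D_{L}u_a‖² + (∮ 2∑ₐ(‖D_xu_a‖² + ⟨u_a,D_xD_xu_a⟩) − 2∮∑ₐ‖D_xu_a‖²) + 3∮ Dp(x)(x) + 2r²∮∑ₐ⟨u_a, N_a⟩`.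
[folklore] -/
theorem sphereEnergy_time_identity {B : Connection 𝔼 𝔤} (hB : ContDiff ℝ 3 B)
    (hval : B.IsValuedIn (skewAdjoint.submodule ℝ 𝔤)) {r : ℝ} (hr : 0 < r) :
    r ^ 2 * sphereIntegral (volume : Measure 𝔼) (fun x => 2 * ∑ a, ⟪hodgeSec 𝕓 B a x,
        ∑ i, covDeriv B (fun y => covDeriv B (hodgeSec 𝕓 B a) y (𝕓 i)) x (𝕓 i) + hodgeNonlin 𝕓 B a x⟫) r =
      -sphereIntegral (volume : Measure 𝔼)
          (fun x => ∑ i, ∑ j, ∑ a, ‖covDeriv B (hodgeSec 𝕓 B a) x (angularField 𝕓 i j x)‖ ^ 2) r +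
        (sphereIntegral (volume : Measure 𝔼) (fun x => 2 * ∑ a, (‖covDeriv B (hodgeSec 𝕓 B a) x x‖ ^ 2 +
            ⟪hodgeSec 𝕓 B a x, covDeriv B (fun y => covDeriv B (hodgeSec 𝕓 B a) y x) x x⟫)) r -
          2 * sphereIntegral (volume : Measure 𝔼) (fun x => ∑ a, ‖covDeriv B (hodgeSec 𝕓 B a) x x‖ ^ 2) r) +
        3 * sphereIntegral (volume : Measure 𝔼)
          (fun x => fderiv ℝ (fun y => ∑ a, ‖hodgeSec 𝕓 B a y‖ ^ 2) x x) r +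
        2 * r ^ 2 * sphereIntegral (volume : Measure 𝔼) (fun x => ∑ a, ⟪hodgeSec 𝕓 B a x, hodgeNonlin 𝕓 B a x⟫) r := by
  have hB1 : ContDiff ℝ 1 B := hB.of_le (by norm_num)
  have hu2 : ∀ a, ContDiff ℝ 2 (hodgeSec 𝕓 B a) := fun a => contDiff_hodgeSec hB a
  -- continuity of `N_a`
  have hNc : ∀ a, Continuous (hodgeNonlin 𝕓 B a) := by
    intro a
    unfold hodgeNonlin
    have hF : ∀ c d, Continuous fun x => curvature B x (𝕓 c) (𝕓 d) := fun c d =>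
      (contDiff_curvature_apply (k := 0) (by rw [show ((0 : WithTop ℕ∞) + 1) = 1 by norm_num]; exact hB1) _ _).continuous
    refine continuous_finsetSum _ fun b _ => continuous_finsetSum _ fun c _ => continuous_finsetSum _ fun d _ => ?_
    have hsc : Continuous fun x : 𝔼 => ((lc4 a b c d : ℤ) : ℝ) * ⟪x, 𝕓 b⟫ :=
      continuous_const.mul (continuous_id.inner continuous_const)
    refine hsc.smul (continuous_finsetSum _ fun i _ => ?_)
    simp only [Ring.lie_def]
    exact ((hF c i).mul (hF i d)).sub ((hF i d).mul (hF c i))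
  -- continuity of the frozen radial pairing, via `Dh − Dp`
  have hrad2 : Continuous fun x : 𝔼 => 2 * ∑ a, (‖covDeriv B (hodgeSec 𝕓 B a) x x‖ ^ 2 +
      ⟪hodgeSec 𝕓 B a x, covDeriv B (fun y => covDeriv B (hodgeSec 𝕓 B a) y x) x x⟫) := by
    have hh1 := contDiff_radialDeriv_sphereEnergyDensity hB
    have h1 : Continuous fun x : 𝔼 => fderiv ℝ (fun y : 𝔼 => fderiv ℝ (fun z => ∑ a, ‖hodgeSec 𝕓 B a z‖ ^ 2) y y) x x :=
      (hh1.continuous_fderiv one_ne_zero).clm_apply continuous_id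
    have heq : (fun x : 𝔼 => 2 * ∑ a, (‖covDeriv B (hodgeSec 𝕓 B a) x x‖ ^ 2 +
        ⟪hodgeSec 𝕓 B a x, covDeriv B (fun y => covDeriv B (hodgeSec 𝕓 B a) y x) x x⟫)) =
        fun x => fderiv ℝ (fun y : 𝔼 => fderiv ℝ (fun z => ∑ a, ‖hodgeSec 𝕓 B a z‖ ^ 2) y y) x x -
          fderiv ℝ (fun y => ∑ a, ‖hodgeSec 𝕓 B a y‖ ^ 2) x x := by
      funext x
      rw [← fderiv_radial_radial_sphereEnergyDensity hB hval x, fderiv_radialDeriv_sphereEnergyDensity hB x]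
      ring
    rw [heq]; exact h1.sub hh1.continuous
  have h := section_sphere_identity hB1 hval hu2 hNc hrad2 hr (n := fun a => hodgeNonlin 𝕓 B a)
  rw [h]
  congr 2
  refine congrArg (fun z => 3 * z) (sphereIntegral_congr_norm hr.le fun x _ => ?_)
  exact (fderiv_sphereEnergyDensity hB hval x x).symm

end Literature.MathematicalPhysics.QuantumLattice
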